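import Summits.BirchSwinnertonDyer.Rank1Residual.Additive.X4SharpThreeKimRefined
import Summits.BirchSwinnertonDyer.Rank1Residual.Additive.X4SharpThreeKimShapeConsequences
import HarnessLib

/-!
# N11 — the LOWER half of BSD at an additive `3` from "Kim (6) at 3" + Kim's REFINED conjecture,
# and the per-row index-certificate closers (cell `b2b-bsdres`, team n1011, seat p03, OWNERS row
# T-a2 — lead's spec PLAN.md §3 T-a2 (ii); THEOREMS ONLY; sequel of
# `Additive/X4SharpThreeKimRefined.lean` and `Additive/X4SharpThreeKimShapeConsequences.lean`)

HONEST FRAMING (cell `b2b-bsdres`, run/shared/lean/b2b/bsd-rank1-residual/, verbatim in every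
file): the goal of the cell is to DELETE the COMBINATION-SHAPED residual classes of the
Birch–Swinnerton-Dyer formula for ALL analytic-rank `≤ 1` elliptic curves over `ℚ` — "full BSD
formula for every rank `≤ 1` curve in class `C`" assembled STRICTLY from published theorems — so
that the rank-`≤ 1` remainder becomes exactly the CONSTRUCTION-SHAPED classes, which are TYPED
(missing-input `Prop`s), NOT attempted. This is not "finishing BSD". Team n1011 (N10 / N11): prove
what is provable now; shrink each hard class to its core with data; no claim beyond stated classes.
Research routes; census output = EVIDENCE / conjecture items, never a Literature fact. The label X4
is UNCHANGED by this file; nothing is booked. Theorems only (no definition, no named fact minted;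
GZK `hGZK` / modularity `hmod` and the cell's named facts explicit; the typed conjectures of
`Additive/X4SharpThreeKimRefined.lean` — clause (6) at `3` in both directions (ANNOUNCED by
Kim–Pollack arXiv:2505.09121v1, PRE) and Kim's refined conjecture 1.10 at `3` (OPEN) — enter ONLY as
explicit hypotheses).

## What this file proves (any prime `p` first, then the N11 census shapes at `p = 3`)

§1 **LOWER from clause (6) + an index certificate** (`missingLowerBoundAt_of_kimLower_of_indexCert`):
`KimRankZeroLowerBoundAt W p` + ONE Kurihara number non-zero mod `p^k` at a cyclic level `n ∈ 𝒩_k`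
with `k − 1 ≤ ord_p ∏ c_ℓ` ⟹ `MissingLowerBoundAt W p` (`ord_p #Ш_an ≤ ord_p #Ш`); hence from the
certificate predicate `KuriharaIndexLeAt … m`, `m ≤ ord_p ∏ c_ℓ`, and from the refined conjecture's
`≤` half (`missingLowerBoundAt_of_kimLower_of_refinedLe`). §2 **UPPER from clause (6)-with-divisibility
+ the refined `≥` half** (`missingUpperBoundAt_of_kimUpperDiv_of_refinedGe`): `ord_p #Ш ≤ ord_p #Ш_an`
WITHOUT any Tamagawa hypothesis. §3 **Both** ⟹ `MissingPPartAt W p` ⟹ `BSD(E,p)` (GZK): the full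
`p`-part on a pair from {clause (6) both directions, refined conjecture both halves} — the lead's
T-a2 (ii) "T-a4-fact ∧ (i) ⟹ MissingLowerBoundAt, hence MissingPPartAt". §4 **N11 census shapes**:
(a) `X4RankZero.bsdp_three_of_kimSix_of_refined` — every X4 ∧ `r_an = 0` ∧ surj(3) ∧ tower row with a
datum `D`, `3 ∤ c_D`, and the period transfer satisfies `BSD(E,3)` MODULO {`X4SharpThreeKimLower`,
`X4SharpThreeKimUpperDiv`} (announced) ∧ {`X4SharpThreeRefinedLe`, `X4SharpThreeRefinedGe`} (open) —
no Tamagawa, no `#Ш_an` hypothesis: the typed content of N11 in Kim's currency; (b) the per-row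
LOWER closer `X4RankZero.missingLowerBoundAt_three_of_kimLower_of_indexCert` (announced direction +
ONE certificate with `k − 1 ≤ ord₃ ∏ c_ℓ`) and, with the cell's SHARP upper-half routes (seven named
facts, `X4RankZero.missingUpperBoundAt_three_of_cert_sharp`), the per-row `BSD(E,3)` closer
`X4RankZero.bsdp_three_of_kimLower_of_indexCert_of_cert_sharp` for the LOWER rows of N11 (V25b: 84 + 1
window rows; one `3`-descent each so far) — conditional only on the ANNOUNCED lower direction, the
published facts, and one modular-symbol computation per row.

References: C.-H. Kim, Amer. J. Math. 148 (2026) = arXiv:2203.12159v4 Thm. 1.9 (6), Conj. 1.10, §1.5.1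
[Kim2022StructureSelmer]; C.-H. Kim (app. R. Pollack), arXiv:2505.09121v1 Thm. 1.1 / Cor. 1.7 (PRE);
Kato 2004 Thm. 14.5 (3), Prop. 14.16 (2), Thm. 17.4 (3) [Kato2004Asterisque]; Delbourgo 1998 Prop. 4
[Delbourgo1998]; Wuthrich 2014 Lemma 20 [Wuthrich2014]; Miller 2011 Def. 1.1 [Miller2011LMS];
Mazur 1977 III §5 [Mazur1977].
-/

noncomputable section

open scoped Classical MatrixGroups ModularForm

open CongruenceSubgroup WeierstrassCurve Literature.NumberTheory.EllipticCurves
  Literature.NumberTheory.EllipticCurves.ModularForms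
  Literature.NumberTheory.EllipticCurves.Rank1Residual
  Literature.NumberTheory.EllipticCurves.Rank1Residual.Typed

namespace Summit.BirchSwinnertonDyer.Rank1Residual.Additive

variable (W : WeierstrassCurve ℚ) [W.IsElliptic] [W.IsGloballyMinimal] (p : ℕ) [Fact p.Prime]

/-! ## §1 The LOWER half from clause (6) and an index certificate -/

/-- **LOWER from clause (6) + ONE index certificate (any prime).** Granted the per-pair LOWER shape
`KimRankZeroLowerBoundAt W p` (Kim's theorem at `5 ≤ p`; announced at `3`), GZK `hGZK`, and on the
pair: `ρ̄` onto, tower, `L(E,1) ≠ 0`, datum `D` with `p ∤ c_D`, period transfer, and a Kurihara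
number `δ̃_n^{(k)} ≠ 0` at a cyclic level `n ∈ 𝒩_k` with `k − 1 ≤ ord_p ∏ c_ℓ` — then
`ord_p #Ш_an ≤ ord_p #Ш` (`MissingLowerBoundAt W p`): `ord_p #Ш_an = ord_p(L/Ω) − ord_p ∏ c_ℓ ≤
ord_p #Ш(p) + (k − 1) − ord_p ∏ c_ℓ ≤ ord_p #Ш`. [cite: Kim2022StructureSelmer, Thm. 1.9 (6), §1.5.1]
[cite: Miller2011LMS, Def. 1.1] [cite: Mazur1977, Ch. III §5, p. 157] -/
theorem missingLowerBoundAt_of_kimLower_of_indexCert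
    (hGZK : rank_eq_analyticRank_of_analyticRank_le_one) (hlow : KimRankZeroLowerBoundAt W p)
    (hsurj : W.HasSurjectiveModNGaloisRep p)
    (htower : ∀ n : ℕ, W.HasSurjectiveModNGaloisRep (p ^ n : ℕ)) (hL : W.entireLFunction 1 ≠ 0)
    {N : ℕ} [NeZero N] (D : ModularParametrizationData W N) (hc : ¬ (p : ℤ) ∣ D.maninConstant)
    (hper : ∃ u : ℚ, ‖(u : ℚ_[p])‖ = 1 ∧ W.realPeriodRat = u * plusPeriod D.f)
    {k n : ℕ} [NeZero n] (hk : 1 ≤ k) (hn : Kato.IsKolyvaginProduct W p k n)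
    (hcyc : ∀ (ℓ : ℕ) [Fact ℓ.Prime], ℓ ∣ n →
      Nat.card {P : ((WeierstrassCurve.integralModelInt W).map
          (Int.castRingHom (ZMod ℓ))).toAffine.Point // p • P = 0} ≤ p)
    (ψ : (ℓ : ℕ) → (ZMod ℓ)ˣ →* Multiplicative (ZMod (p ^ k)))
    (hψ : ∀ ℓ ∈ n.primeFactors, Function.Surjective (ψ ℓ))
    (hδ : kuriharaNumber D.f (p ^ k) n ψ ≠ 0)
    (hkt : k - 1 ≤ padicValNat p W.tamagawaProduct) : MissingLowerBoundAt W p := by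
  have hr0 : W.analyticRank = 0 := analyticRank_eq_zero_of_entireLFunction_one_ne_zero hL
  obtain ⟨hmw, hfin⟩ := hGZK W (by rw [hr0]; exact zero_le_one)
  haveI : Finite W.sha := hfin
  obtain ⟨q₀, hq₀, hle⟩ := hlow hsurj htower hL hfin D hc hper k n hk hn hcyc ψ hψ hδ
  have hq₀0 : q₀ ≠ 0 := rankZero_witness_ne_zero W hL hq₀
  have hirr := hasIrreducibleModPGaloisRep_of_hasSurjectiveModNGaloisRep W p hsurj
  refine ⟨q₀ * (W.torsionOrder : ℚ) ^ 2 / (W.tamagawaProduct : ℚ),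
    shaAn_eq_of_rankZero_witness W hmw hL hq₀, ?_⟩
  have hsha : padicValNat p (Nat.card (AddCommGroup.primaryComponent W.sha p)) =
      padicValNat p W.shaOrder := by
    unfold WeierstrassCurve.shaOrder
    exact padicValNat_card_addPrimaryComponent p
  have hkt' : ((k - 1 : ℕ) : ℤ) ≤ (padicValNat p W.tamagawaProduct : ℤ) := by exact_mod_cast hkt
  rw [Supersingular.padicValRat_shaAn_witness W p hirr hq₀0, ← hsha]
  linarith

/-- **LOWER from clause (6) + the certificate predicate `KuriharaIndexLeAt … m` with
`m ≤ ord_p ∏ c_ℓ`.** [cite: Kim2022StructureSelmer, Thm. 1.9 (6), §1.5.1] [cite: Miller2011LMS, Def. 1.1] -/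
theorem missingLowerBoundAt_of_kimLower_of_indexLe
    (hGZK : rank_eq_analyticRank_of_analyticRank_le_one) (hlow : KimRankZeroLowerBoundAt W p)
    (hsurj : W.HasSurjectiveModNGaloisRep p)
    (htower : ∀ n : ℕ, W.HasSurjectiveModNGaloisRep (p ^ n : ℕ)) (hL : W.entireLFunction 1 ≠ 0)
    {N : ℕ} [NeZero N] (D : ModularParametrizationData W N) (hc : ¬ (p : ℤ) ∣ D.maninConstant)
    (hper : ∃ u : ℚ, ‖(u : ℚ_[p])‖ = 1 ∧ W.realPeriodRat = u * plusPeriod D.f)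
    {m : ℕ} (hidx : KuriharaIndexLeAt W p D.f m) (hm : m ≤ padicValNat p W.tamagawaProduct) :
    MissingLowerBoundAt W p := by
  obtain ⟨k, n, hn0, hk1, hkm, hn, hcyc, ψ, hψ, hδ⟩ := hidx
  exact missingLowerBoundAt_of_kimLower_of_indexCert W p hGZK hlow hsurj htower hL D hc hper hk1 hn
    hcyc ψ hψ hδ (by omega)

/-- **LOWER from clause (6) + the refined conjecture's `≤` half** (`KimRefinedIndexLeAt W p`:
some cyclic-level Kurihara number has index `≤ ord_p ∏ c_ℓ`): `MissingLowerBoundAt W p`. The lead's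
T-a2 (ii) "T-a4-fact ∧ (i) ⟹ MissingLowerBoundAt". [cite: Kim2022StructureSelmer, Thm. 1.9 (6), Conj. 1.10]
[cite: Miller2011LMS, Def. 1.1] -/
theorem missingLowerBoundAt_of_kimLower_of_refinedLe
    (hGZK : rank_eq_analyticRank_of_analyticRank_le_one) (hlow : KimRankZeroLowerBoundAt W p)
    (href : KimRefinedIndexLeAt W p) (hsurj : W.HasSurjectiveModNGaloisRep p)
    (htower : ∀ n : ℕ, W.HasSurjectiveModNGaloisRep (p ^ n : ℕ)) (hL : W.entireLFunction 1 ≠ 0)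
    {N : ℕ} [NeZero N] (D : ModularParametrizationData W N) (hc : ¬ (p : ℤ) ∣ D.maninConstant)
    (hper : ∃ u : ℚ, ‖(u : ℚ_[p])‖ = 1 ∧ W.realPeriodRat = u * plusPeriod D.f) :
    MissingLowerBoundAt W p :=
  missingLowerBoundAt_of_kimLower_of_indexLe W p hGZK hlow hsurj htower hL D hc hper
    (href hsurj htower hL D hc hper) le_rfl

/-! ## §2 The UPPER half from clause (6)-with-divisibility and the refined `≥` half -/

/-- **UPPER from clause (6)-with-divisibility + the refined `≥` half (any prime, NO Tamagawa
hypothesis).** `KimRankZeroUpperDivBoundAt W p` at `m = ord_p ∏ c_ℓ`, whose divisibility premise is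
exactly `KimRefinedIndexGeAt W p`, gives `ord_p #Ш(p) + ord_p ∏ c_ℓ ≤ ord_p(L/Ω)`, i.e.
`ord_p #Ш ≤ ord_p #Ш_an` (`MissingUpperBoundAt W p`). [cite: Kim2022StructureSelmer, Thm. 1.9 (6), Conj. 1.10]
[cite: Miller2011LMS, Def. 1.1] [cite: Mazur1977, Ch. III §5, p. 157] -/
theorem missingUpperBoundAt_of_kimUpperDiv_of_refinedGe
    (hGZK : rank_eq_analyticRank_of_analyticRank_le_one) (hud : KimRankZeroUpperDivBoundAt W p)
    (hge : KimRefinedIndexGeAt W p) (hsurj : W.HasSurjectiveModNGaloisRep p)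
    (htower : ∀ n : ℕ, W.HasSurjectiveModNGaloisRep (p ^ n : ℕ)) (hL : W.entireLFunction 1 ≠ 0)
    {N : ℕ} [NeZero N] (D : ModularParametrizationData W N) (hc : ¬ (p : ℤ) ∣ D.maninConstant)
    (hper : ∃ u : ℚ, ‖(u : ℚ_[p])‖ = 1 ∧ W.realPeriodRat = u * plusPeriod D.f) :
    MissingUpperBoundAt W p := by
  have hr0 : W.analyticRank = 0 := analyticRank_eq_zero_of_entireLFunction_one_ne_zero hL
  obtain ⟨hmw, hfin⟩ := hGZK W (by rw [hr0]; exact zero_le_one)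
  haveI : Finite W.sha := hfin
  obtain ⟨q₀, hq₀, hle⟩ := hud hsurj htower hL hfin D hc hper (padicValNat p W.tamagawaProduct)
    (fun k n _ hk hn ψ hψ => hge hsurj htower hL D hc hper k n hk hn ψ hψ)
  have hq₀0 : q₀ ≠ 0 := rankZero_witness_ne_zero W hL hq₀
  have hirr := hasIrreducibleModPGaloisRep_of_hasSurjectiveModNGaloisRep W p hsurj
  refine ⟨q₀ * (W.torsionOrder : ℚ) ^ 2 / (W.tamagawaProduct : ℚ),
    shaAn_eq_of_rankZero_witness W hmw hL hq₀, ?_⟩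
  have hsha : padicValNat p (Nat.card (AddCommGroup.primaryComponent W.sha p)) =
      padicValNat p W.shaOrder := by
    unfold WeierstrassCurve.shaOrder
    exact padicValNat_card_addPrimaryComponent p
  rw [Supersingular.padicValRat_shaAn_witness W p hirr hq₀0, ← hsha]
  linarith

/-! ## §3 Both halves: the `p`-part from {clause (6) both directions, refined conjecture both halves} -/

/-- **`MissingPPartAt W p` from clause (6) (both directions) and the refined conjecture (both
halves)** on a pair with `ρ̄` onto, tower, `L(E,1) ≠ 0`, datum `D` with `p ∤ c_D`, period transfer —
NO Tamagawa and NO `#Ш_an` hypothesis. [cite: Kim2022StructureSelmer, Thm. 1.9 (6), Conj. 1.10]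
[cite: Miller2011LMS, Def. 1.1] -/
theorem missingPPartAt_of_kimSix_of_refined
    (hGZK : rank_eq_analyticRank_of_analyticRank_le_one) (hlow : KimRankZeroLowerBoundAt W p)
    (hud : KimRankZeroUpperDivBoundAt W p) (href : KimRefinedIndexLeAt W p)
    (hge : KimRefinedIndexGeAt W p) (hsurj : W.HasSurjectiveModNGaloisRep p)
    (htower : ∀ n : ℕ, W.HasSurjectiveModNGaloisRep (p ^ n : ℕ)) (hL : W.entireLFunction 1 ≠ 0)
    {N : ℕ} [NeZero N] (D : ModularParametrizationData W N) (hc : ¬ (p : ℤ) ∣ D.maninConstant)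
    (hper : ∃ u : ℚ, ‖(u : ℚ_[p])‖ = 1 ∧ W.realPeriodRat = u * plusPeriod D.f) :
    MissingPPartAt W p :=
  missingPPartAt_of_lower_of_upper W p
    (missingLowerBoundAt_of_kimLower_of_refinedLe W p hGZK hlow href hsurj htower hL D hc hper)
    (missingUpperBoundAt_of_kimUpperDiv_of_refinedGe W p hGZK hud hge hsurj htower hL D hc hper)

/-- **`BSD(E,p)` from clause (6) and the refined conjecture** (Miller; GZK for rank and finiteness).
[cite: Kim2022StructureSelmer, Thm. 1.9 (6), Conj. 1.10] [cite: Miller2011LMS, §1 and Def. 1.1] -/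
theorem bsdp_of_kimSix_of_refined
    (hGZK : rank_eq_analyticRank_of_analyticRank_le_one) (hlow : KimRankZeroLowerBoundAt W p)
    (hud : KimRankZeroUpperDivBoundAt W p) (href : KimRefinedIndexLeAt W p)
    (hge : KimRefinedIndexGeAt W p) (hsurj : W.HasSurjectiveModNGaloisRep p)
    (htower : ∀ n : ℕ, W.HasSurjectiveModNGaloisRep (p ^ n : ℕ)) (hL : W.entireLFunction 1 ≠ 0)
    {N : ℕ} [NeZero N] (D : ModularParametrizationData W N) (hc : ¬ (p : ℤ) ∣ D.maninConstant)
    (hper : ∃ u : ℚ, ‖(u : ℚ_[p])‖ = 1 ∧ W.realPeriodRat = u * plusPeriod D.f) : BSDp W p :=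
  bsdp_of_missingPPartAt W p hGZK
    (by rw [analyticRank_eq_zero_of_entireLFunction_one_ne_zero hL]; exact zero_le_one)
    (missingPPartAt_of_kimSix_of_refined W p hGZK hlow hud href hge hsurj htower hL D hc hper)

/-! ## §4 N11 census shapes at `p = 3` -/

/-- **N11 MODULO {clause (6) at 3 (announced)} ∧ {refined conjecture at 3 (open)}**: every X4 ∧
`r_an = 0` ∧ surj(3) ∧ tower row (tower from a `j`-witness ∨ surj(9) certificate) with a datum `D`,
`3 ∤ c_D`, and the period transfer satisfies `BSD(E,3)` — the typed content of N11 in Kim's currency,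
with NO Tamagawa and NO `#Ш_an` hypothesis (so the LOWER, TAM-DEFECT and ODD-SHA residue pieces of
`x4SharpUnitFree_iff_lower_and_residues_sharp` at `3` are all inside). CONDITIONAL on the four typed
conjectures; GZK, modularity. [cite: Kim2022StructureSelmer, Thm. 1.9 (6), Conj. 1.10]
[cite: SerreAbelianLadic1968, Ch. IV §3.4] [cite: Miller2011LMS, §1 and Def. 1.1] -/
theorem X4RankZero.bsdp_three_of_kimSix_of_refined (hL3 : X4SharpThreeKimLower)
    (hU3 : X4SharpThreeKimUpperDiv) (hRle : X4SharpThreeRefinedLe) (hRge : X4SharpThreeRefinedGe)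
    (hGZK : rank_eq_analyticRank_of_analyticRank_le_one) (hmod : hasEntireLFunction_rat)
    (hr : W.analyticRank = 0) (hX : ClassX4 W 3) (hsurj : Surj W 3)
    (hcert : (∃ q : ℕ, q.Prime ∧ q ≠ 3 ∧ padicValRat q W.j < 0 ∧ ¬ (3 : ℤ) ∣ padicValRat q W.j) ∨
      W.HasSurjectiveModNGaloisRep 9)
    {N : ℕ} [NeZero N] (D : ModularParametrizationData W N) (hc : ¬ (3 : ℤ) ∣ D.maninConstant)
    (hper : ∃ u : ℚ, ‖(u : ℚ_[3])‖ = 1 ∧ W.realPeriodRat = u * plusPeriod D.f) : BSDp W 3 :=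
  bsdp_of_kimSix_of_refined W 3 hGZK (hL3 W hX.2.1) (hU3 W hX.2.1) (hRle W hX.2.1) (hRge W hX.2.1)
    hsurj (towerSurj_three_of_surj_of_jWitness_or_nine W hsurj hcert)
    ((W.analyticRank_eq_zero_iff_holds (hmod W)).mp hr) D hc hper

/-- **N11 LOWER half MODULO {clause (6)-LOWER at 3 (announced)} ∧ {refined `≤` half at 3 (open)}**
on every tower row with a datum and period transfer. The lead's T-a2 (ii), first clause.
[cite: Kim2022StructureSelmer, Thm. 1.9 (6), Conj. 1.10] [cite: Miller2011LMS, Def. 1.1] -/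
theorem X4RankZero.missingLowerBoundAt_three_of_kimLower_of_refinedLe (hL3 : X4SharpThreeKimLower)
    (hRle : X4SharpThreeRefinedLe)
    (hGZK : rank_eq_analyticRank_of_analyticRank_le_one) (hmod : hasEntireLFunction_rat)
    (hr : W.analyticRank = 0) (hX : ClassX4 W 3) (hsurj : Surj W 3)
    (htower : ∀ n : ℕ, W.HasSurjectiveModNGaloisRep (3 ^ n : ℕ))
    {N : ℕ} [NeZero N] (D : ModularParametrizationData W N) (hc : ¬ (3 : ℤ) ∣ D.maninConstant)
    (hper : ∃ u : ℚ, ‖(u : ℚ_[3])‖ = 1 ∧ W.realPeriodRat = u * plusPeriod D.f) :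
    MissingLowerBoundAt W 3 :=
  missingLowerBoundAt_of_kimLower_of_refinedLe W 3 hGZK (hL3 W hX.2.1) (hRle W hX.2.1) hsurj htower
    ((W.analyticRank_eq_zero_iff_holds (hmod W)).mp hr) D hc hper

/-- **PER-ROW LOWER closer at 3: clause (6)-LOWER (announced) + ONE index certificate.** On an
X4 ∧ `r_an = 0` ∧ surj(3) ∧ tower row with a datum `D`, `3 ∤ c_D`, the period transfer, and a Kurihara
number `δ̃_n^{(k)} ≠ 0` at a cyclic level `n ∈ 𝒩_k(E,3)` with `k − 1 ≤ ord₃ ∏ c_ℓ`: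
`MissingLowerBoundAt W 3`. For the LOWER rows of N11 with `3 ∤ ∏ c_ℓ` this is `k = 1` (a UNIT).
CONDITIONAL on `X4SharpThreeKimLower`. [cite: Kim2022StructureSelmer, Thm. 1.9 (6), §1.5.1]
[cite: Miller2011LMS, Def. 1.1] -/
theorem X4RankZero.missingLowerBoundAt_three_of_kimLower_of_indexCert (hL3 : X4SharpThreeKimLower)
    (hGZK : rank_eq_analyticRank_of_analyticRank_le_one) (hmod : hasEntireLFunction_rat)
    (hr : W.analyticRank = 0) (hX : ClassX4 W 3) (hsurj : Surj W 3)
    (htower : ∀ n : ℕ, W.HasSurjectiveModNGaloisRep (3 ^ n : ℕ))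
    {N : ℕ} [NeZero N] (D : ModularParametrizationData W N) (hc : ¬ (3 : ℤ) ∣ D.maninConstant)
    (hper : ∃ u : ℚ, ‖(u : ℚ_[3])‖ = 1 ∧ W.realPeriodRat = u * plusPeriod D.f)
    {k n : ℕ} [NeZero n] (hk : 1 ≤ k) (hn : Kato.IsKolyvaginProduct W 3 k n)
    (hcyc : ∀ (ℓ : ℕ) [Fact ℓ.Prime], ℓ ∣ n →
      Nat.card {P : ((WeierstrassCurve.integralModelInt W).map
          (Int.castRingHom (ZMod ℓ))).toAffine.Point // 3 • P = 0} ≤ 3)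
    (ψ : (ℓ : ℕ) → (ZMod ℓ)ˣ →* Multiplicative (ZMod (3 ^ k)))
    (hψ : ∀ ℓ ∈ n.primeFactors, Function.Surjective (ψ ℓ))
    (hδ : kuriharaNumber D.f (3 ^ k) n ψ ≠ 0) (hkt : k - 1 ≤ padicValNat 3 W.tamagawaProduct) :
    MissingLowerBoundAt W 3 :=
  missingLowerBoundAt_of_kimLower_of_indexCert W 3 hGZK (hL3 W hX.2.1) hsurj htower
    ((W.analyticRank_eq_zero_iff_holds (hmod W)).mp hr) D hc hper hk hn hcyc ψ hψ hδ hkt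

/-- **PER-ROW `BSD(E,3)` closer for the LOWER rows of N11**: clause (6)-LOWER at 3 (announced,
`hL3`) + ONE index certificate (`k − 1 ≤ ord₃ ∏ c_ℓ`) for the lower half, and the cell's SHARP
upper-half routes (seven named facts: sharp Kato A161 `hKatoS`, Delbourgo Prop. 4 `hDel`, `hmodD`,
Wuthrich L. 20 `hL20`, `ω`-component `hKatoω`, GZK, modularity) with their certificate
`hcertU` (`ord₃ j < 0`, or a tower certificate with `ord₃ ∏ c_ℓ = ord₃ c₃`) for the upper half. On a
LOWER row (`3 ∣ #Ш_an`, `3 ∤ ∏ c_ℓ`) the certificate is a UNIT Kurihara number (`k = 1`) and `hcertU`'s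
Tamagawa clause is `0 = 0`. [cite: Kato2004Asterisque, Thm. 14.5 (3) (p. 236), Thm. 17.4 (3) (p. 273)]
[cite: Delbourgo1998, Prop. 4 (p. 144)] [cite: Kim2022StructureSelmer, Thm. 1.9 (6)] [cite: Miller2011LMS, §1 and Def. 1.1] -/
theorem X4RankZero.bsdp_three_of_kimLower_of_indexCert_of_cert_sharp (hL3 : X4SharpThreeKimLower)
    (hKatoS : Kato2004.rankZero_padicValNat_sha_le_sub_localTamagawa_of_additive_potGood_of_imageContainsSL2)
    (hDel : Delbourgo1998.prop4_rankZero_pow_dvd_constantCoeff)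
    (hGZK : rank_eq_analyticRank_of_analyticRank_le_one) (hmod : hasEntireLFunction_rat)
    (hmodD : nonempty_modularParametrizationData)
    (hL20 : Wuthrich2014.lemma20_surjective_threeAdic_of_semistable)
    (hKatoω : Wuthrich2014.kato_minusEigenCharIdeal_dvd_cyclotomicThree_of_surjective)
    (hr : W.analyticRank = 0) (hX : ClassX4 W 3) (hsurj : Surj W 3)
    (htower : ∀ n : ℕ, W.HasSurjectiveModNGaloisRep (3 ^ n : ℕ))
    (hcertU : padicValRat 3 W.j < 0 ∨
      ((∃ q : ℕ, q.Prime ∧ q ≠ 3 ∧ padicValRat q W.j < 0 ∧ ¬ (3 : ℤ) ∣ padicValRat q W.j) ∨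
        W.HasSurjectiveModNGaloisRep 9) ∧
      padicValNat 3 W.tamagawaProduct =
        padicValNat 3 ((WeierstrassCurve.baseChange W ℚ_[3]).localTamagawaNumber ℤ_[3]))
    {N : ℕ} [NeZero N] (D : ModularParametrizationData W N) (hc : ¬ (3 : ℤ) ∣ D.maninConstant)
    (hper : ∃ u : ℚ, ‖(u : ℚ_[3])‖ = 1 ∧ W.realPeriodRat = u * plusPeriod D.f)
    {k n : ℕ} [NeZero n] (hk : 1 ≤ k) (hn : Kato.IsKolyvaginProduct W 3 k n)
    (hcyc : ∀ (ℓ : ℕ) [Fact ℓ.Prime], ℓ ∣ n →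
      Nat.card {P : ((WeierstrassCurve.integralModelInt W).map
          (Int.castRingHom (ZMod ℓ))).toAffine.Point // 3 • P = 0} ≤ 3)
    (ψ : (ℓ : ℕ) → (ZMod ℓ)ˣ →* Multiplicative (ZMod (3 ^ k)))
    (hψ : ∀ ℓ ∈ n.primeFactors, Function.Surjective (ψ ℓ))
    (hδ : kuriharaNumber D.f (3 ^ k) n ψ ≠ 0) (hkt : k - 1 ≤ padicValNat 3 W.tamagawaProduct) :
    BSDp W 3 :=
  bsdp_of_missingPPartAt W 3 hGZK (by rw [hr]; exact zero_le_one)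
    (missingPPartAt_of_lower_of_upper W 3
      (X4RankZero.missingLowerBoundAt_three_of_kimLower_of_indexCert W hL3 hGZK hmod hr hX hsurj htower
        D hc hper hk hn hcyc ψ hψ hδ hkt)
      (X4RankZero.missingUpperBoundAt_three_of_cert_sharp W hKatoS hDel hGZK hmod hmodD hL20 hKatoω hr hX
        hsurj hcertU D hc))

end Summit.BirchSwinnertonDyer.Rank1Residual.Additive

end
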